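/-
Copyright (c) 2026 the pub-hodgecm-mathlib formalisation cell (harness21).  Prover seat hodgecm-mathlib-K2E3-p27 (g4), Track B «K2-LIT», h413 = `stmt-HodgeConjecture-24833`,
route `HCCMUnconditional`, R90-TF S8; S8 dealer R90-CS-plan (g4) J-S8-X12: brick X1-β of the #4′ top-row self-dual letter (census `K2/K2E3-p27/g4/CENSUS-X1-topRow.K2E3-p27-g4.md`
0dac5aacfe2fef50) — the ANALYTIC INSTANCE: along K2E1-p12's concentrating Mellin profiles the atom coordinate is EXACTLY the basis atom and the line mass dies in `L²`.
-/
import Summits.HodgeConjecture.HodgeConjecture.Theorems.K2E1MellinProfileConcentrationCMTwo     -- ★ p865100 (K2E1-p12): `exists_mellinProfiles_concentrating`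
import Summits.HodgeConjecture.HodgeConjecture.Theorems.K2E1ChiSectionPlancherelKTypeCMTwo        -- ★ (K2E1 estate): `memLp_two_mellin_neg_axis`, `continuous_mellin_neg_axis` (Mellin–Plancherel on the axis)
import HarnessLib

/-!
# S8 #4′ road — `R90S8MellinProfileLineMassVanishes` (X1-β): ALONG CONCENTRATING MELLIN PROFILES THE LINE MASS OF ★ M1's MODEL DIES IN `L²`

Track B ∕ K2-LIT, crux h413 = `stmt-HodgeConjecture-24833`, route of record `HCCMUnconditional`; cell `hodgecm-mathlib`, R90-TF S8 «ContSpec-n½», socket #4′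
`sock_S8_resH_spannedByCharLines` (B ED. 7 :494), TOP ROW `(K_max, 1)`, self-dual letter, bricks X1∕X2 (one hand, J-S8-X12).  THEOREMS ONLY (no `def`, no `instance`, no `notation`, no
named-fact hypothesis, no `sorry`; default heartbeats); lane `--supports stmt-HodgeConjecture-24833 --as helper` (count-neutral).  CLOSES NO SOCKET.  GENERIC real analysis (Mathlib
`mellin`, `MemLp`, ★ K2E1 Mellin–Plancherel leaves); no automorphic object.

THE MATHEMATICS ([MoeglinWaldspurger1995, II.1.12, IV.1.11]; [Titchmarsh1948, §1.29, Thm 71–72]).  In ★ M1's sqrt model (`exists_linearIsometry_chiSection_selfDual_m1_letterFree_sqrt_cm_two`) the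
brick of a profile `f` has atom coordinates `√C·T_c(M[f](−c)·v)` and line coordinate `t ↦ M[f](−(½+it))·v + s(½−it)·M[f](−(½−it))·v` on `(0,∞)`, with `σ(t) = s(½−it)` essentially
bounded (★ FILE B).  K2E1-p12's ★ `exists_mellinProfiles_concentrating` gives profiles `f_n` with `M[f_n](−c₀) = 1`, `M[f_n](−c) = 0` at the other poles and `‖M[f_n](s)‖ ≤ ε_n‖M[g](s)‖` on
`Re s = −½`, `ε_n → 0`, for any `g ∈ C²_c((0,∞))` with `M[g](−c₀) ≠ 0`.  Hence the atom coordinates of `[θ_{f_n}]` are EXACTLY the basis atom at `c₀` (n-independent), and the line function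
`F_n` is dominated a.e. by `ε_n·G`, `G(t) = ‖v‖(‖M[g](−½−it)‖ + B‖M[g](−½+it)‖) ∈ L²` (★ `memLp_two_mellin_neg_axis` and its reflection `t ↦ −t`), so `‖F_n‖₂ ≤ ε_n‖G‖₂ → 0`.  With X1-α
(★ `exists_atomVectors_of_tendsto`) this yields the ATOM VECTORS `R_c = lim [θ_{f_n}]` of the block and `resHAtom = span {R_c}` (X1); X2 identifies `R_c` with the residue class.
* §1 `memLp_two_mellin_neg_axis_neg` — the reflected axis transform `t ↦ M[g](−(½−it))` is in `L²(ℝ)`.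
* §2 **`exists_profiles_lineMass_tendsto_zero`** — THE HEAD: profiles `f_n` (the five clauses of ★ p865100) such that the line functions `F_n` are in `L²((0,∞); W)` and `‖F_n‖₂ → 0`
  (hypothesis-first on the bump `g` with `M[g](−c₀) ≠ 0` and on `σ ∈ L^∞`).
HONEST LABEL: HC_CM is proved only modulo the 7 printed citations (2 remaining named inputs: hLiu418 = `stmt-HodgeConjecture-24832`, h413 = `stmt-HodgeConjecture-24833`) until rung 0
closes; generic leaf, pays nothing by itself (X1-γ packaging + X2 remain); count-neutral; unconditional.

## References
* [MoeglinWaldspurger1995] C. Mœglin, J.-L. Waldspurger, *Spectral Decomposition and Eisenstein Series* (1995), II.1.12, IV.1.11.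
* [Titchmarsh1948] E. C. Titchmarsh, *Introduction to the Theory of Fourier Integrals* (2nd ed., 1948), §1.29, Thm 71–72.
-/

set_option autoImplicit false
set_option linter.dupNamespace false  -- the mandated namespace `…HodgeConjecture.HodgeConjecture.R90.S8` (LEAD #1 L1) repeats the summit's segment

noncomputable section

open MeasureTheory Set Filter Topology Complex
open scoped ENNReal
open Summit.HodgeConjecture.HodgeConjecture.Cruxes.H413.K2E1MellinProfileConcentrationCMTwo (exists_mellinProfiles_concentrating)
open Summit.HodgeConjecture.HodgeConjecture.Cruxes.H413.K2E1ChiSectionPlancherelKTypeCMTwo (memLp_two_mellin_neg_axis continuous_mellin_neg_axis)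

namespace Summit.HodgeConjecture.HodgeConjecture.R90.S8

/-! ## §1 The reflected axis transform is square-integrable -/

/-- **`t ↦ M[g](−(½ − it)) ∈ L²(ℝ)`** for `g ∈ C²_c((0,∞))`: the axis transform ★ `memLp_two_mellin_neg_axis` composed with the measure-preserving reflection `t ↦ −t`.
[cite: Titchmarsh1948, Thm 71–72] -/
theorem memLp_two_mellin_neg_axis_neg {g : ℝ → ℂ} (hg : ContDiff ℝ 2 g) (hgs : HasCompactSupport g) (hg0 : tsupport g ⊆ Ioi 0) :
    MemLp (fun t : ℝ => mellin g (-((((1 / 2 : ℝ)) : ℂ) + ((-t : ℝ) : ℂ) * I))) 2 (volume : Measure ℝ) :=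
  (memLp_two_mellin_neg_axis hg hgs hg0).comp_measurePreserving (Measure.measurePreserving_neg (volume : Measure ℝ))

/-! ## §2 The head: concentrating profiles with vanishing line mass -/

/-- **CONCENTRATING PROFILES KILL THE LINE MASS (X1-β).**  `S` the (finite) pole set, `c₀ ∈ ℝ` with `½ < c₀`, a profile `g ∈ C²_c((0,∞))` with `M[g](−c₀) ≠ 0`, a vector `v` of a normed
`ℂ`-space `W`, and an essentially bounded `σ : (0,∞) → ℂ` (★ M1's `t ↦ s(½−it)`).  Then there are profiles `f_n ∈ C²_c((0,∞))` with `M[f_n](−c₀) = 1`, `M[f_n](−c) = 0` for `c ∈ S`,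
`c ≠ c₀` (★ K2E1-p12), whose LINE FUNCTIONS `F_n(t) = M[f_n](−(½+it))·v + σ(t)·M[f_n](−(½−it))·v` — ★ M1's `w`-formula — lie in `L²((0,∞); W)` with `‖F_n‖₂ → 0`: a.e.
`‖F_n(t)‖ ≤ ε_n·G(t)`, `G = ‖v‖(‖M[g](−½−i·)‖ + B‖M[g](−½+i·)‖) ∈ L²` (`σ` a.e.-measurable with an a.e. bound `B` — from ★ FILE B's `MemLp σ ∞`). [cite: MoeglinWaldspurger1995, II.1.12, IV.1.11] [cite: Titchmarsh1948, Thm 71–72] -/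
theorem exists_profiles_lineMass_tendsto_zero
    (S : Finset ℝ) {c₀ : ℝ} (hc : 1 / 2 < c₀)
    {g : ℝ → ℂ} (hg : ContDiff ℝ 2 g) (hgs : HasCompactSupport g) (hg0 : tsupport g ⊆ Ioi 0) (hG : mellin g (-(c₀ : ℂ)) ≠ 0)
    {W : Type*} [NormedAddCommGroup W] [NormedSpace ℂ W] (v : W)
    (σ : ℝ → ℂ) (hσm : AEStronglyMeasurable σ ((volume : Measure ℝ).restrict (Ioi 0)))
    (Bσ : ℝ) (hσae : ∀ᵐ t ∂((volume : Measure ℝ).restrict (Ioi 0)), ‖σ t‖ ≤ Bσ) :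
    ∃ f : ℕ → ℝ → ℂ,
      (∀ n, ContDiff ℝ 2 (f n)) ∧ (∀ n, HasCompactSupport (f n)) ∧ (∀ n, tsupport (f n) ⊆ Ioi 0) ∧
      (∀ n, mellin (f n) (-(c₀ : ℂ)) = 1) ∧ (∀ n, ∀ c ∈ S, c ≠ c₀ → mellin (f n) (-(c : ℂ)) = 0) ∧
      (∀ n, MemLp (fun t : ℝ => mellin (f n) (-((((1 / 2 : ℝ)) : ℂ) + t * I)) • v + σ t • mellin (f n) (-((((1 / 2 : ℝ)) : ℂ) + ((-t : ℝ) : ℂ) * I)) • v) 2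
        ((volume : Measure ℝ).restrict (Ioi 0))) ∧
      Tendsto (fun n => eLpNorm (fun t : ℝ => mellin (f n) (-((((1 / 2 : ℝ)) : ℂ) + t * I)) • v + σ t • mellin (f n) (-((((1 / 2 : ℝ)) : ℂ) + ((-t : ℝ) : ℂ) * I)) • v) 2
        ((volume : Measure ℝ).restrict (Ioi 0))) atTop (𝓝 0) := by
  obtain ⟨f, ε, hf2, hfs, hf0, hf1, hfS, hε0, hεt, hεb⟩ := exists_mellinProfiles_concentrating S hc hg hgs hg0 hG
  -- the non-negative bound and the dominating `L²` function `G`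
  have hB : ∀ᵐ t ∂((volume : Measure ℝ).restrict (Ioi 0)), ‖σ t‖ ≤ max Bσ 0 := by
    filter_upwards [hσae] with t ht using ht.trans (le_max_left _ _)
  have hB0 : 0 ≤ max Bσ 0 := le_max_right _ _
  have hGmem : MemLp (fun t : ℝ => ‖v‖ * (‖mellin g (-((((1 / 2 : ℝ)) : ℂ) + t * I))‖ + max Bσ 0 * ‖mellin g (-((((1 / 2 : ℝ)) : ℂ) + ((-t : ℝ) : ℂ) * I))‖)) 2
      ((volume : Measure ℝ).restrict (Ioi 0)) :=
    (((memLp_two_mellin_neg_axis hg hgs hg0).restrict (Ioi 0)).norm.add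
      (((memLp_two_mellin_neg_axis_neg hg hgs hg0).restrict (Ioi 0)).norm.const_mul (max Bσ 0))).const_mul ‖v‖
  -- the real part of the two axis points is `−½`
  have hre : ∀ t : ℝ, (-((((1 / 2 : ℝ)) : ℂ) + (t : ℂ) * I)).re = -(1 / 2) := fun t => by simp
  have hre' : ∀ t : ℝ, (-((((1 / 2 : ℝ)) : ℂ) + ((-t : ℝ) : ℂ) * I)).re = -(1 / 2) := fun t => by simp
  -- a.e. domination `‖F_n‖ ≤ ε_n·‖G‖`
  have hdom : ∀ n, ∀ᵐ t : ℝ ∂((volume : Measure ℝ).restrict (Ioi 0)),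
      ‖mellin (f n) (-((((1 / 2 : ℝ)) : ℂ) + (t : ℂ) * I)) • v + σ t • mellin (f n) (-((((1 / 2 : ℝ)) : ℂ) + ((-t : ℝ) : ℂ) * I)) • v‖ ≤
        ε n * ‖‖v‖ * (‖mellin g (-((((1 / 2 : ℝ)) : ℂ) + t * I))‖ + max Bσ 0 * ‖mellin g (-((((1 / 2 : ℝ)) : ℂ) + ((-t : ℝ) : ℂ) * I))‖)‖ := fun n => by
    filter_upwards [hB] with t ht
    have h1 := hεb n _ (hre t)
    have h2 := hεb n _ (hre' t)
    have hGnn : 0 ≤ ‖v‖ * (‖mellin g (-((((1 / 2 : ℝ)) : ℂ) + t * I))‖ + max Bσ 0 * ‖mellin g (-((((1 / 2 : ℝ)) : ℂ) + ((-t : ℝ) : ℂ) * I))‖) := by positivity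
    rw [Real.norm_of_nonneg hGnn]
    calc ‖mellin (f n) (-((((1 / 2 : ℝ)) : ℂ) + t * I)) • v + σ t • mellin (f n) (-((((1 / 2 : ℝ)) : ℂ) + ((-t : ℝ) : ℂ) * I)) • v‖
        ≤ ‖mellin (f n) (-((((1 / 2 : ℝ)) : ℂ) + t * I))‖ * ‖v‖ + ‖σ t‖ * (‖mellin (f n) (-((((1 / 2 : ℝ)) : ℂ) + ((-t : ℝ) : ℂ) * I))‖ * ‖v‖) := by
          refine (norm_add_le _ _).trans (add_le_add ?_ ?_)
          · rw [norm_smul]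
          · rw [norm_smul, norm_smul]
      _ ≤ ε n * ‖mellin g (-((((1 / 2 : ℝ)) : ℂ) + t * I))‖ * ‖v‖ + max Bσ 0 * (ε n * ‖mellin g (-((((1 / 2 : ℝ)) : ℂ) + ((-t : ℝ) : ℂ) * I))‖ * ‖v‖) := by
          gcongr
      _ = ε n * (‖v‖ * (‖mellin g (-((((1 / 2 : ℝ)) : ℂ) + t * I))‖ + max Bσ 0 * ‖mellin g (-((((1 / 2 : ℝ)) : ℂ) + ((-t : ℝ) : ℂ) * I))‖)) := by ring
  -- measurability of `F_n`
  have hmeas : ∀ n, AEStronglyMeasurable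
      (fun t : ℝ => mellin (f n) (-((((1 / 2 : ℝ)) : ℂ) + t * I)) • v + σ t • mellin (f n) (-((((1 / 2 : ℝ)) : ℂ) + ((-t : ℝ) : ℂ) * I)) • v)
      ((volume : Measure ℝ).restrict (Ioi 0)) := fun n =>
    ((continuous_mellin_neg_axis (hf2 n).continuous (hfs n) (hf0 n)).aestronglyMeasurable.smul aestronglyMeasurable_const).add
      (hσm.smul (((continuous_mellin_neg_axis (hf2 n).continuous (hfs n) (hf0 n)).comp continuous_neg).aestronglyMeasurable.smul
        aestronglyMeasurable_const))
  refine ⟨f, hf2, hfs, hf0, hf1, hfS, fun n => MemLp.of_le_mul hGmem (hmeas n) (hdom n), ?_⟩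
  -- `‖F_n‖₂ ≤ ε_n·‖G‖₂ → 0`
  have hle : ∀ n, eLpNorm (fun t : ℝ => mellin (f n) (-((((1 / 2 : ℝ)) : ℂ) + t * I)) • v + σ t • mellin (f n) (-((((1 / 2 : ℝ)) : ℂ) + ((-t : ℝ) : ℂ) * I)) • v) 2
      ((volume : Measure ℝ).restrict (Ioi 0)) ≤
      ENNReal.ofReal (ε n) * eLpNorm (fun t : ℝ => ‖v‖ * (‖mellin g (-((((1 / 2 : ℝ)) : ℂ) + t * I))‖ + max Bσ 0 * ‖mellin g (-((((1 / 2 : ℝ)) : ℂ) + ((-t : ℝ) : ℂ) * I))‖)) 2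
        ((volume : Measure ℝ).restrict (Ioi 0)) := fun n =>
    eLpNorm_le_mul_eLpNorm_of_ae_le_mul (hdom n) 2
  have hlim : Tendsto (fun n => ENNReal.ofReal (ε n) * eLpNorm (fun t : ℝ => ‖v‖ * (‖mellin g (-((((1 / 2 : ℝ)) : ℂ) + t * I))‖ + max Bσ 0 * ‖mellin g (-((((1 / 2 : ℝ)) : ℂ) + ((-t : ℝ) : ℂ) * I))‖)) 2
      ((volume : Measure ℝ).restrict (Ioi 0))) atTop (𝓝 0) := by
    have h0 : Tendsto (fun n => ENNReal.ofReal (ε n)) atTop (𝓝 0) := by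
      simpa only [ENNReal.ofReal_zero] using ENNReal.tendsto_ofReal hεt
    simpa only [zero_mul] using ENNReal.Tendsto.mul_const h0 (Or.inr hGmem.2.ne)
  exact tendsto_of_tendsto_of_tendsto_of_le_of_le tendsto_const_nhds hlim (fun _ => zero_le) hle

end Summit.HodgeConjecture.HodgeConjecture.R90.S8

end
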